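import Literature.NumberTheory.Transcendental.RoyPadicRank
import Literature.Barriers.Schanuel.AlgebraicIndependenceOfLogarithmsRoyKernels
import HarnessLib

/-!
# Roy 1992, §5 Theorem 5 for `K = ℚ̄_p`, deduced from Theorem 4 (the printed proof, pp. 39–40)

Topic `Literature/NumberTheory/Transcendental` (namespace `Literature.NumberTheory.Transcendental`,
helpers in the grouping sub-namespace `RoyPadic`). Companion of
`Literature.NumberTheory.Transcendental.RoyPadicRank`, which vendors Roy's Theorem 4
(`roy1992_padic_thm4`) and Theorem 5 (`roy1992_padic_thm5`) for the `p`-adic field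
`K = ℚ̄_p = PadicAlgCl p`, `ℚ̄ = padicQbar p`, as NAMED FACTS. Source: D. Roy, *Matrices whose
coefficients are linear forms in logarithms*, J. Number Theory 41 (1992) 22–47 [`Roy1992`],
Theorem 5 and its proof, pp. 39–40 (read from the materialised text).

## What is proved here

* `RoyPadic.phi_add_le` — superadditivity of Roy's `φ`: `φ(n₁,d₁) + φ(n₂,d₂) ≤ φ(n₁+n₂, d₁+d₂)`
  (concatenate decompositions; the step "`l ≤ φ(n*,d*) + φ(n',d') ≤ φ(n,d)`", p. 40).
* `RoyPadic.finrank_pos_and_lt` — the first assertion of Theorem 5, UNCONDITIONALLY: if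
  `U ∩ ℚ̄^d = 0` and `K^d` is the smallest `ℚ̄`-rational subspace containing `U` (`d > 0`), then
  `0 < dim_K U < d`.
* `roy1992_padic_thm5_of_thm4 : roy1992_padic_thm4 p → roy1992_padic_thm5 p` — **Theorem 4 ⇒
  Theorem 5**, following the printed proof verbatim: induction on `d`; a rational surjection
  `t : K^d → K^{d'}` minimising `dim t(U)/d'`; Theorem 4 gives `l'/(d'+l') ≤ n'/d' ≤ n/d`, whence
  `0 < n' < d'` and `l' ≤ n'd'/(d'−n') ≤ φ(n',d')`; if `d' = d` then `t` is an isomorphism; if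
  `d' < d` one transports `U`, `Z` along a rational injection `i : K^{d*} → K^d` onto `ker t`
  (`U* = i⁻¹(U)`, `Z* = i⁻¹(Z)`), checks the hypotheses for `U*` (the envelope `T₁ = K^{d*}` by the
  minimality of `t` applied to a rational surjection `t₁` with kernel `i(T₁)`), applies the
  induction hypothesis, and adds up `l = l* + l'`, `n = n* + n'`, `d = d* + d'`.

So `roy1992_padic_thm5` is CLOSED MODULO `roy1992_padic_thm4` (Roy's main theorem, resting on
Waldschmidt's `p`-adic linear subgroup theorem — not in the tree): once
`roy1992_padic_thm4_holds` lands, `roy1992_padic_thm5_holds := roy1992_padic_thm5_of_thm4 (…)`.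

## Tools

The `ℚ̄`-structure dictionary for a field extension `K/F` of
`Literature.Barriers.Schanuel.AlgebraicIndependenceOfLogarithmsRationalLemmas` and
`…RoyKernels` (namespace `Literature.Barriers.Schanuel.Roy1992`: `incl`, `spanK`, `fPoints`,
`finrank_spanK`, `ker_mulVecLin_map`, `exists_surjective_ker_eq_spanK`,
`exists_injective_range_eq_spanK`, `exists_leftInverse_map`, `finrank_map_add_finrank_comap`),
instantiated at `F = padicQbar p`, `K = PadicAlgCl p`; the bridge to the vocabulary of
`RoyPadicRank` (`IsRationalMap` = "given by a matrix over `ℚ̄`", `IsRationalSubspace T` ⟺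
`spanK (fPoints T) = T`) is proved below.

## References

* [Roy1992] D. Roy, J. Number Theory 41 (1992) 22–47: §4 Theorem 4 (p. 34); §5 definition of
  `φ` (pp. 38–39), Theorem 5 and its proof (pp. 39–40).
-/

noncomputable section

open Module Submodule

namespace Literature.NumberTheory.Transcendental

namespace RoyPadic

open Literature.Barriers.Schanuel.Roy1992

variable {p : ℕ} [Fact p.Prime]

/-! ### Superadditivity of `φ` [Roy1992, §5 proof of Theorem 5, p. 40] -/

/-- Concatenating decompositions of `(n₁, d₁)` and `(n₂, d₂)` gives a decomposition of
`(n₁ + n₂, d₁ + d₂)`. [folklore] -/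
theorem isDecomposition_append {n₁ d₁ k₁ n₂ d₂ k₂ : ℕ} {ns₁ ds₁ : Fin k₁ → ℕ} {ns₂ ds₂ : Fin k₂ → ℕ}
    (h₁ : IsDecomposition n₁ d₁ k₁ ns₁ ds₁) (h₂ : IsDecomposition n₂ d₂ k₂ ns₂ ds₂) :
    IsDecomposition (n₁ + n₂) (d₁ + d₂) (k₁ + k₂) (Fin.append ns₁ ns₂) (Fin.append ds₁ ds₂) := by
  obtain ⟨hlt₁, hns₁, hds₁⟩ := h₁
  obtain ⟨hlt₂, hns₂, hds₂⟩ := h₂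
  refine ⟨fun i => ?_, ?_, ?_⟩
  · refine Fin.addCases (fun j => ?_) (fun j => ?_) i
    · simpa using hlt₁ j
    · simpa using hlt₂ j
  · rw [Fin.sum_univ_add]
    simp [hns₁, hns₂]
  · rw [Fin.sum_univ_add]
    simp [hds₁, hds₂]

/-- The attached sum of a concatenation is the sum of the attached sums. [folklore] -/
theorem decompSum_append {k₁ k₂ : ℕ} (ns₁ ds₁ : Fin k₁ → ℕ) (ns₂ ds₂ : Fin k₂ → ℕ) :
    decompSum (k₁ + k₂) (Fin.append ns₁ ns₂) (Fin.append ds₁ ds₂) =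
      decompSum k₁ ns₁ ds₁ + decompSum k₂ ns₂ ds₂ := by
  unfold decompSum
  rw [Fin.sum_univ_add]
  simp

/-- The set of attached sums of `(n, d)` is non-empty when `0 < n < d`. [folklore] -/
theorem decompSums_nonempty {n d : ℕ} (hn : 0 < n) (hnd : n < d) : (decompSums n d).Nonempty :=
  ⟨_, 1, _, _, isDecomposition_single hn hnd, rfl⟩

/-- **Superadditivity of Roy's `φ`**: `φ(n₁, d₁) + φ(n₂, d₂) ≤ φ(n₁ + n₂, d₁ + d₂)` for
`0 < nᵢ < dᵢ` (the union of a decomposition of `(n₁, d₁)` and one of `(n₂, d₂)` is a decomposition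
of the sum; used on p. 40: "`l ≤ φ(n*, d*) + φ(n', d') ≤ φ(n, d)`").
[cite: Roy1992, §5 proof of Theorem 5 (p. 40)] -/
theorem phi_add_le {n₁ d₁ n₂ d₂ : ℕ} (hn₁ : 0 < n₁) (h₁ : n₁ < d₁) (hn₂ : 0 < n₂) (h₂ : n₂ < d₂) :
    phi n₁ d₁ + phi n₂ d₂ ≤ phi (n₁ + n₂) (d₁ + d₂) := by
  have key : ∀ x ∈ decompSums n₁ d₁, ∀ y ∈ decompSums n₂ d₂, x + y ≤ phi (n₁ + n₂) (d₁ + d₂) := by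
    rintro x ⟨k₁, ns₁, ds₁, hd₁, rfl⟩ y ⟨k₂, ns₂, ds₂, hd₂, rfl⟩
    rw [← decompSum_append]
    exact decompSum_le_phi (isDecomposition_append hd₁ hd₂)
  have h2 : ∀ x ∈ decompSums n₁ d₁, phi n₂ d₂ ≤ phi (n₁ + n₂) (d₁ + d₂) - x := fun x hx =>
    csSup_le (decompSums_nonempty hn₂ h₂) fun y hy => by linarith [key x hx y hy]
  have h1 : phi n₁ d₁ ≤ phi (n₁ + n₂) (d₁ + d₂) - phi n₂ d₂ :=
    csSup_le (decompSums_nonempty hn₁ h₁) fun x hx => by linarith [h2 x hx]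
  linarith

/-! ### The `ℚ̄`-structure of `K^d`: bridge to the dictionary of `Roy1992` -/

/-- A map given by a matrix with entries in `ℚ̄` is rational over `ℚ̄`. [folklore] -/
theorem isRationalMap_mulVecLin_map {m n : ℕ} (A : Matrix (Fin m) (Fin n) (padicQbar p)) :
    IsRationalMap (A.map (algebraMap (padicQbar p) (PadicAlgCl p))).mulVecLin := by
  intro v hv j
  let v₀ : Fin n → padicQbar p := fun i => ⟨v i, hv i⟩
  have hv₀ : v = incl (padicQbar p) (PadicAlgCl p) n v₀ := funext fun i => rfl
  rw [hv₀, map_mulVec_incl, incl_apply]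
  exact SetLike.coe_mem _

/-- The matrix of a map rational over `ℚ̄` has entries in `ℚ̄`. [folklore] -/
theorem toMatrix'_mem_of_isRationalMap {d₁ d₂ : ℕ}
    {t : (Fin d₁ → PadicAlgCl p) →ₗ[PadicAlgCl p] (Fin d₂ → PadicAlgCl p)}
    (ht : IsRationalMap t) (i : Fin d₂) (j : Fin d₁) :
    LinearMap.toMatrix' t i j ∈ padicQbar p := by
  rw [LinearMap.toMatrix'_apply]
  refine ht _ (fun k => ?_) i
  by_cases h : k = j
  · subst h; simp
  · simp [h]

/-- **A map rational over `ℚ̄` is given by a matrix with entries in `ℚ̄`.** [folklore] -/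
theorem exists_eq_mulVecLin_of_isRationalMap {m n : ℕ}
    {t : (Fin n → PadicAlgCl p) →ₗ[PadicAlgCl p] (Fin m → PadicAlgCl p)} (ht : IsRationalMap t) :
    ∃ A : Matrix (Fin m) (Fin n) (padicQbar p),
      t = (A.map (algebraMap (padicQbar p) (PadicAlgCl p))).mulVecLin := by
  refine ⟨fun i j => ⟨LinearMap.toMatrix' t i j, toMatrix'_mem_of_isRationalMap ht i j⟩, ?_⟩
  have h : (Matrix.map (fun i j => (⟨LinearMap.toMatrix' t i j, toMatrix'_mem_of_isRationalMap ht i j⟩ :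
      padicQbar p)) (algebraMap (padicQbar p) (PadicAlgCl p))) = LinearMap.toMatrix' t := by
    ext i j; rfl
  rw [h, ← Matrix.toLin'_apply', Matrix.toLin'_toMatrix']

/-- The `ℚ̄`-points of a `K`-subspace `T ⊆ K^d`, as a subset of `K^d`, are the images under the
inclusion `ℚ̄^d → K^d` of `fPoints T`. [folklore] -/
theorem setOf_mem_and_forall_mem_eq {d : ℕ} (T : Submodule (PadicAlgCl p) (Fin d → PadicAlgCl p)) :
    {v : Fin d → PadicAlgCl p | v ∈ T ∧ ∀ i, v i ∈ padicQbar p} =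
      incl (padicQbar p) (PadicAlgCl p) d '' (fPoints (F := padicQbar p) T) := by
  ext v
  constructor
  · rintro ⟨hvT, hv⟩
    refine ⟨fun i => ⟨v i, hv i⟩, ?_, funext fun i => rfl⟩
    have hv' : incl (padicQbar p) (PadicAlgCl p) d (fun i => ⟨v i, hv i⟩) = v := funext fun i => rfl
    rw [SetLike.mem_coe, mem_fPoints, hv']
    exact hvT
  · rintro ⟨x, hx, rfl⟩
    exact ⟨hx, fun i => SetLike.coe_mem _⟩

/-- **Bridge**: `T` is rational over `ℚ̄` (generated by its `ℚ̄`-points) iff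
`T = spanK (fPoints T)`. [folklore] -/
theorem isRationalSubspace_iff {d : ℕ} (T : Submodule (PadicAlgCl p) (Fin d → PadicAlgCl p)) :
    IsRationalSubspace T ↔ spanK (PadicAlgCl p) (fPoints (F := padicQbar p) T) = T := by
  rw [IsRationalSubspace, setOf_mem_and_forall_mem_eq, spanK]

/-- The `K`-span of an `F`-subspace of `ℚ̄^d` is rational over `ℚ̄`. [folklore] -/
theorem isRationalSubspace_spanK {d : ℕ} (T₀ : Submodule (padicQbar p) (Fin d → padicQbar p)) :
    IsRationalSubspace (spanK (PadicAlgCl p) T₀) := by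
  rw [isRationalSubspace_iff, fPoints_spanK]

/-- The trivial subspace is rational over `ℚ̄`. [folklore] -/
theorem isRationalSubspace_bot (d : ℕ) :
    IsRationalSubspace (⊥ : Submodule (PadicAlgCl p) (Fin d → PadicAlgCl p)) := by
  rw [IsRationalSubspace]
  refine le_antisymm (span_le.2 fun v hv => hv.1) bot_le

/-- **Kernels of rational maps are rational.** [folklore] -/
theorem isRationalSubspace_ker {d₁ d₂ : ℕ}
    {t : (Fin d₁ → PadicAlgCl p) →ₗ[PadicAlgCl p] (Fin d₂ → PadicAlgCl p)} (ht : IsRationalMap t) :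
    IsRationalSubspace (LinearMap.ker t) := by
  obtain ⟨A, rfl⟩ := exists_eq_mulVecLin_of_isRationalMap ht
  rw [ker_mulVecLin_map]
  exact isRationalSubspace_spanK _

/-- A matrix over `ℚ̄` maps `𝓛̃^d` into `𝓛̃^{d'}` (`𝓛̃` is a `ℚ̄`-vector space). [folklore] -/
theorem mulVec_map_mem_logLinearForms {d d' : ℕ} (A : Matrix (Fin d') (Fin d) (padicQbar p))
    {z : Fin d → PadicAlgCl p} (hz : ∀ i, z i ∈ logLinearForms p) (j : Fin d') :
    (A.map (algebraMap (padicQbar p) (PadicAlgCl p))).mulVec z j ∈ logLinearForms p := by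
  rw [Matrix.mulVec, dotProduct]
  refine sum_mem fun i _ => ?_
  have h : algebraMap (padicQbar p) (PadicAlgCl p) (A j i) * z i = (A j i) • z i := by
    rw [IntermediateField.smul_def, smul_eq_mul]; rfl
  rw [Matrix.map_apply, h]
  exact Submodule.smul_mem _ _ (hz i)

/-! ### A minimising rational surjection exists [Roy1992, §5 proof of Theorem 5, p. 39] -/

/-- A surjection onto `K^{d₁}` with `d₁ > 0` is non-zero. [folklore] -/
theorem ne_zero_of_surjective {d d₁ : ℕ} (hd₁ : 0 < d₁)
    {t : (Fin d → PadicAlgCl p) →ₗ[PadicAlgCl p] (Fin d₁ → PadicAlgCl p)}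
    (ht : Function.Surjective t) : t ≠ 0 := by
  intro h
  obtain ⟨w, hw⟩ := ht fun _ => 1
  have := congrFun hw ⟨0, hd₁⟩
  simp [h] at this

/-- A non-zero map to `K^{d₁}` has `d₁ > 0`. [folklore] -/
theorem pos_of_ne_zero {d d₁ : ℕ} {t : (Fin d → PadicAlgCl p) →ₗ[PadicAlgCl p] (Fin d₁ → PadicAlgCl p)}
    (ht : t ≠ 0) : 0 < d₁ := by
  rcases Nat.eq_zero_or_pos d₁ with rfl | h
  · exact absurd (LinearMap.ext fun v => funext fun i => Fin.elim0 i) ht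
  · exact h

/-- Among the surjective, non-zero `K`-linear maps `K^d → K^{d'}` rational over `ℚ̄` (`d > 0`),
some `t` minimises `dim(t(U))/d'` (the ratio takes finitely many values: `d' ≤ d`,
`dim t(U) ≤ d`); port of the complex-case
`Literature.Barriers.Schanuel.exists_minimal_rationalMap`. [folklore] -/
theorem exists_minimal_rationalMap {d : ℕ} (hd : 0 < d)
    (U : Submodule (PadicAlgCl p) (Fin d → PadicAlgCl p)) :
    ∃ (d' : ℕ) (t : (Fin d → PadicAlgCl p) →ₗ[PadicAlgCl p] (Fin d' → PadicAlgCl p)),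
      Function.Surjective t ∧ IsRationalMap t ∧ t ≠ 0 ∧
      ∀ (d'' : ℕ) (t' : (Fin d → PadicAlgCl p) →ₗ[PadicAlgCl p] (Fin d'' → PadicAlgCl p)),
        Function.Surjective t' → IsRationalMap t' → t' ≠ 0 →
        (finrank (PadicAlgCl p) (U.map t) : ℝ) / d' ≤ (finrank (PadicAlgCl p) (U.map t') : ℝ) / d'' := by
  set S : Set ℝ := {x | ∃ (d' : ℕ) (t : (Fin d → PadicAlgCl p) →ₗ[PadicAlgCl p] (Fin d' → PadicAlgCl p)),
    Function.Surjective t ∧ IsRationalMap t ∧ t ≠ 0 ∧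
    x = (finrank (PadicAlgCl p) (U.map t) : ℝ) / d'} with hS
  have hne : S.Nonempty :=
    ⟨_, d, LinearMap.id, Function.surjective_id, isRationalMap_id d,
      ne_zero_of_surjective hd Function.surjective_id, rfl⟩
  have hfin : S.Finite := by
    refine Set.Finite.subset ((Finset.finite_toSet (Finset.range (d + 1) ×ˢ Finset.range (d + 1))).image
      fun q : ℕ × ℕ => (q.1 : ℝ) / (q.2 : ℝ)) ?_
    rintro x ⟨d', t, ht, -, -, rfl⟩
    refine ⟨(finrank (PadicAlgCl p) (U.map t), d'), ?_, rfl⟩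
    have hd' : d' ≤ d := by
      have := LinearMap.finrank_le_finrank_of_surjective ht
      simpa using this
    have hU : finrank (PadicAlgCl p) (U.map t) ≤ d := by
      have h1 : finrank (PadicAlgCl p) (U.map t) ≤ finrank (PadicAlgCl p) (Fin d' → PadicAlgCl p) :=
        Submodule.finrank_le _
      rw [finrank_fin_fun] at h1
      omega
    simp only [Finset.coe_product, Finset.coe_range, Set.mem_prod, Set.mem_Iio]
    omega
  obtain ⟨d', t, ht, hrat, hne0, heq⟩ := hne.csInf_mem hfin
  refine ⟨d', t, ht, hrat, hne0, fun d'' t' ht' hrat' hne' => ?_⟩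
  rw [← heq]
  exact csInf_le hfin.bddBelow ⟨d'', t', ht', hrat', hne', rfl⟩

/-! ### The first assertion of Theorem 5: `0 < dim U < d` (unconditional) -/

/-- **Roy 1992, Theorem 5, first assertion** (unconditionally): if `d > 0`, `U ∩ ℚ̄^d = 0` and
`K^d` is the smallest subspace rational over `ℚ̄` containing `U`, then `0 < dim_K U < d`
(`U = 0` would make `0` the envelope; `U = K^d` would contain the rational point `e₁`).
[cite: Roy1992, §5 Theorem 5 (p. 39)] -/
theorem finrank_pos_and_lt {d : ℕ} (hd : 0 < d) (U : Submodule (PadicAlgCl p) (Fin d → PadicAlgCl p))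
    (hU0 : ∀ u ∈ U, (∀ i, u i ∈ padicQbar p) → u = 0)
    (henv : ∀ T : Submodule (PadicAlgCl p) (Fin d → PadicAlgCl p), IsRationalSubspace T → U ≤ T → T = ⊤) :
    0 < finrank (PadicAlgCl p) U ∧ finrank (PadicAlgCl p) U < d := by
  have he : (Pi.single ⟨0, hd⟩ (1 : PadicAlgCl p) : Fin d → PadicAlgCl p) ≠ 0 := by
    intro h
    have := congrFun h ⟨0, hd⟩
    simp at this
  have hrat : ∀ i, (Pi.single ⟨0, hd⟩ (1 : PadicAlgCl p) : Fin d → PadicAlgCl p) i ∈ padicQbar p := by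
    intro i
    by_cases h : i = ⟨0, hd⟩
    · subst h; simp
    · simp [h]
  constructor
  · rw [pos_iff_ne_zero, Ne, Submodule.finrank_eq_zero]
    intro hU
    have htop := henv ⊥ (isRationalSubspace_bot d) (by rw [hU])
    have hmem : (Pi.single ⟨0, hd⟩ (1 : PadicAlgCl p) : Fin d → PadicAlgCl p) ∈
        (⊥ : Submodule (PadicAlgCl p) (Fin d → PadicAlgCl p)) := by
      rw [htop]; exact mem_top
    exact he ((Submodule.mem_bot _).1 hmem)
  · have hU : U ≠ ⊤ := by
      intro hU
      exact he (hU0 _ (by rw [hU]; exact mem_top) hrat)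
    have := Submodule.finrank_lt hU
    simpa using this

/-! ### Rank–nullity bookkeeping -/

/-- **Rank–nullity on a subspace**: `dim f(V) + dim (V ∩ ker f) = dim V`. [folklore] -/
theorem finrank_map_add_finrank_inf_ker {K E E' : Type*} [Field K] [AddCommGroup E] [Module K E]
    [AddCommGroup E'] [Module K E'] [FiniteDimensional K E] (f : E →ₗ[K] E') (V : Submodule K E) :
    finrank K (V.map f) + finrank K ↥(V ⊓ LinearMap.ker f) = finrank K V := by
  have h := LinearMap.finrank_range_add_finrank_ker (f.domRestrict V)
  rw [LinearMap.range_domRestrict, LinearMap.ker_domRestrict] at h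
  have h2 : finrank K ↥(comap V.subtype (LinearMap.ker f)) = finrank K ↥(V ⊓ LinearMap.ker f) := by
    rw [← Submodule.finrank_map_subtype_eq, Submodule.map_comap_subtype]
  omega

/-- Exactness `Im(i) = ker(t)` is preserved by restricting scalars to `ℚ̄`. [folklore] -/
theorem range_restrictScalars_eq_ker {a d d' : ℕ}
    {i : (Fin a → PadicAlgCl p) →ₗ[PadicAlgCl p] (Fin d → PadicAlgCl p)}
    {t : (Fin d → PadicAlgCl p) →ₗ[PadicAlgCl p] (Fin d' → PadicAlgCl p)}
    (hex : LinearMap.range i = LinearMap.ker t) :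
    LinearMap.range (i.restrictScalars (padicQbar p)) =
      LinearMap.ker (t.restrictScalars (padicQbar p)) := by
  ext x
  rw [LinearMap.mem_ker, LinearMap.restrictScalars_apply, ← LinearMap.mem_ker, ← hex,
    LinearMap.mem_range, LinearMap.mem_range]
  rfl

end RoyPadic

/-! ### Theorem 4 ⇒ Theorem 5 [Roy1992, §5, pp. 39–40] -/

section ThmFive

open RoyPadic Literature.Barriers.Schanuel.Roy1992

variable (p : ℕ) [Fact p.Prime]

set_option maxHeartbeats 400000 in
/-- **Roy 1992, Theorem 5 for `K = ℚ̄_p`, deduced from Theorem 4** — the printed proof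
(pp. 39–40): "Let `Z` be a `ℚ̄`-vector subspace of `U ∩ 𝓛̃^d` of finite dimension `l`, and let
`t : K^d → K^{d'}` be a surjective `K`-linear mapping which is rational over `ℚ̄` and non-zero, for
which the ratio `dim_K(t(U))/d'` is minimal. We put `U' = t(U)`, `n' = dim_K(U')`, `Z' = t(Z)`,
`l' = dim_ℚ̄(Z')`. Then Theorem 4 gives `l'/(d'+l') ≤ n'/d' ≤ n/d` (1). Since `d` is positive, the
assumption `U ∩ ℚ̄^d = 0` implies `n < d`. We also have `n' > 0`; otherwise `U` would be contained
in the kernel of `t`, which is rational over `ℚ̄` and distinct from `K^d`. Making use of (1), we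
deduce `0 < n' < d'` and `l' ≤ n'd'/(d'−n') ≤ φ(n',d')`. If `d' = d`, we also have `l' = l` and
`n' = n`, because `t` is then an isomorphism … Now, assume `d' < d`. We put `d* = d − d'`, and we
choose an injective `K`-linear mapping `i : K^{d*} → K^d` which is rational over `ℚ̄`, whose image
is the kernel of `t`. Again we put `U* = i⁻¹(U)`, `n* = dim_K(U*)`, `Z* = i⁻¹(Z)`, `l* = dim_ℚ̄(Z*)`.
Let `T₁` be the smallest subspace of `K^{d*}` which is rational over `ℚ̄` and which contains `U*`.
To show `T₁ = K^{d*}`, we consider a surjective `K`-linear mapping `t₁ : K^d → K^{d₁}` which is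
rational over `ℚ̄`, with kernel `i(T₁)`. It satisfies `U ∩ ker(t) ⊂ ker(t₁) ⊂ ker(t)`. It is thus
non-zero and satisfies `dim_K(t₁(U)) = dim_K(t(U))`. Because of the choice of `t`, this implies
`d₁ ≤ d'`, thus `T₁ = K^{d*}`. We also have `U* ∩ ℚ̄^{d*} = 0`, since `i` is injective and maps
`U* ∩ ℚ̄^{d*}` in `U ∩ ℚ̄^d`. Since `d* < d`, we may suppose, by induction on `d`, that the theorem
is true for the subspace `U*` of `K^{d*}`. Since `Z*` is a `ℚ̄`-vector subspace of `U* ∩ 𝓛̃^{d*}`, we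
get in this way `0 < n* < d*` and `l* ≤ φ(n*, d*)`. Moreover, the choice of `i` implies
`l = l* + l'`, `n = n* + n'`, `d = d* + d'`. Together with (2), these relations imply `0 < n < d`
and `l ≤ φ(n*, d*) + φ(n', d') ≤ φ(n, d)`." (`Z* ⊆ 𝓛̃^{d*}` because `i` has a left inverse given
by a matrix over `ℚ̄`.) With this, `roy1992_padic_thm5` is closed modulo the named fact
`roy1992_padic_thm4`. [cite: Roy1992, §5 Theorem 5 and its proof (pp. 39–40)] -/
theorem roy1992_padic_thm5_of_thm4 (h4 : roy1992_padic_thm4 p) : roy1992_padic_thm5 p := by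
  intro d
  induction d using Nat.strong_induction_on with
  | _ d ih =>
  intro hd U hU0 henv
  obtain ⟨hn0, hnd⟩ := finrank_pos_and_lt hd U hU0 henv
  refine ⟨hn0, hnd, fun Z hZfin hZU hZlog => ?_⟩
  -- a minimising rational surjection `t : K^d → K^{d'}`, given by a matrix `A` over `ℚ̄`
  obtain ⟨d', t, ht, hrat, hne, hmin⟩ := exists_minimal_rationalMap hd U
  obtain ⟨A, rfl⟩ := exists_eq_mulVecLin_of_isRationalMap hrat
  -- Theorem 4: `l'/(d'+l') ≤ n'/d' ≤ n/d`
  obtain ⟨h4a, h4b⟩ := h4 d hd Z U hZfin hZlog hZU d' _ ht hrat hne hmin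
  set t := (A.map (algebraMap (padicQbar p) (PadicAlgCl p))).mulVecLin with ht_def
  set n := finrank (PadicAlgCl p) U with hn_def
  set n' := finrank (PadicAlgCl p) (U.map t) with hn'_def
  set l' := finrank (padicQbar p) (Z.map (t.restrictScalars (padicQbar p))) with hl'_def
  have hd'0 : 0 < d' := pos_of_ne_zero hne
  -- `n' > 0`: otherwise `U ⊆ ker t`, a rational subspace distinct from `K^d`
  have hn'0 : 0 < n' := by
    rw [pos_iff_ne_zero, Ne, hn'_def, Submodule.finrank_eq_zero]
    intro hUt
    have hUker : U ≤ LinearMap.ker t := LinearMap.le_ker_iff_map.2 hUt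
    have htop := henv _ (isRationalSubspace_ker hrat) hUker
    exact hne (LinearMap.ker_eq_top.1 htop)
  have hdR : (0 : ℝ) < d := by exact_mod_cast hd
  have hd'R : (0 : ℝ) < d' := by exact_mod_cast hd'0
  have hn'R : (0 : ℝ) < n' := by exact_mod_cast hn'0
  have hndR : (n : ℝ) < d := by exact_mod_cast hnd
  -- `0 < n' < d'`
  have hn'd' : n' < d' := by
    have h : (n' : ℝ) / d' < 1 :=
      calc (n' : ℝ) / d' ≤ n / d := h4b
        _ < 1 := by rwa [div_lt_one hdR]
    rw [div_lt_one hd'R] at h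
    exact_mod_cast h
  -- `l' ≤ n'd'/(d' − n') ≤ φ(n', d')`
  have hl'phi : (l' : ℝ) ≤ phi n' d' := by
    refine le_trans ?_ (div_le_phi hn'0 hn'd')
    have hlt : (n' : ℝ) < d' := by exact_mod_cast hn'd'
    have hgap : (0 : ℝ) < (d' : ℝ) - n' := by linarith
    rw [le_div_iff₀ hgap]
    have hl'0 : (0 : ℝ) ≤ l' := Nat.cast_nonneg _
    have h := h4a
    rw [div_le_div_iff₀ (by linarith) hd'R] at h
    linarith
  have hd'le : d' ≤ d := by simpa using LinearMap.finrank_le_finrank_of_surjective ht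
  rcases hd'le.eq_or_lt with hdd | hlt
  · -- `d' = d`: `t` is an isomorphism, `n' = n` and `l' = l`
    subst hdd
    have hinj : Function.Injective t := LinearMap.injective_iff_surjective.2 ht
    have hn'n : n' = n :=
      (LinearEquiv.finrank_eq (Submodule.equivMapOfInjective t hinj U)).symm
    have hinjF : Function.Injective (t.restrictScalars (padicQbar p)) := fun x y h => hinj h
    have hl'l : l' = finrank (padicQbar p) Z :=
      (LinearEquiv.finrank_eq (Submodule.equivMapOfInjective _ hinjF Z)).symm
    rw [← hl'l, ← hn'n]
    exact hl'phi
  · -- `d' < d`: transport along a rational injection `i : K^a → K^d` onto `ker t`, `a = d − d'`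
    set W₀ : Submodule (padicQbar p) (Fin d → padicQbar p) := LinearMap.ker A.mulVecLin with hW₀
    have hker : LinearMap.ker t = spanK (PadicAlgCl p) W₀ := ker_mulVecLin_map A
    have hkerdim : finrank (PadicAlgCl p) (LinearMap.ker t) + d' = d := by
      have h1 := LinearMap.finrank_range_add_finrank_ker t
      rw [LinearMap.range_eq_top.2 ht, finrank_top, finrank_fin_fun, finrank_fin_fun] at h1
      omega
    have hW₀dim : finrank (padicQbar p) W₀ + d' = d := by
      rw [← finrank_spanK (K := PadicAlgCl p) W₀, ← hker]; exact hkerdim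
    obtain ⟨a, B, ha, hiinj, hirange⟩ := exists_injective_range_eq_spanK (K := PadicAlgCl p) W₀
    obtain ⟨C, hCB⟩ := exists_leftInverse_map B hiinj
    set i := (B.map (algebraMap (padicQbar p) (PadicAlgCl p))).mulVecLin with hi_def
    have hex : LinearMap.range i = LinearMap.ker t := by rw [hirange, hker]
    have had : a + d' = d := by rw [ha]; exact hW₀dim
    have ha_lt : a < d := by omega
    have ha0 : 0 < a := by omega
    have hCi : ∀ x, (C.map (algebraMap (padicQbar p) (PadicAlgCl p))).mulVec (i x) = x := by
      intro x
      rw [hi_def, Matrix.mulVecLin_apply, Matrix.mulVec_mulVec, hCB, Matrix.one_mulVec]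
    have hBinj : Function.Injective B.mulVecLin := by
      intro x y hxy
      apply incl_injective (F := padicQbar p) (K := PadicAlgCl p) a
      apply hiinj
      rw [map_mulVec_incl, map_mulVec_incl, hxy]
    -- `U* = i⁻¹(U)`
    set Us : Submodule (PadicAlgCl p) (Fin a → PadicAlgCl p) := U.comap i with hUs_def
    have hUs0 : ∀ u ∈ Us, (∀ k, u k ∈ padicQbar p) → u = 0 := by
      intro u hu hurat
      have hiu : i u = 0 := hU0 _ hu (fun j => isRationalMap_mulVecLin_map B u hurat j)
      exact hiinj (by rw [hiu, map_zero])
    -- the envelope of `U*` is `K^a` (minimality of `t` against `t₁` with kernel `i(T)`)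
    have hUsenv : ∀ T : Submodule (PadicAlgCl p) (Fin a → PadicAlgCl p),
        IsRationalSubspace T → Us ≤ T → T = ⊤ := by
      intro T hT hUsT
      have hTeq : spanK (PadicAlgCl p) (fPoints (F := padicQbar p) T) = T :=
        (isRationalSubspace_iff T).1 hT
      set T₀ := fPoints (F := padicQbar p) T with hT₀
      set T₁ : Submodule (padicQbar p) (Fin d → padicQbar p) := T₀.map B.mulVecLin with hT₁
      have hmapT : T.map i = spanK (PadicAlgCl p) T₁ := by
        conv_lhs => rw [← hTeq]
        rw [spanK, Submodule.map_span, spanK, hT₁, Submodule.map_coe, ← Set.image_comp,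
          ← Set.image_comp]
        congr 1
        refine Set.image_congr fun x _ => ?_
        simp only [Function.comp_apply]
        exact map_mulVec_incl B x
      obtain ⟨d₁, A₁, hd₁, hsurj₁, hker₁⟩ := exists_surjective_ker_eq_spanK (K := PadicAlgCl p) T₁
      set t₁ := (A₁.map (algebraMap (padicQbar p) (PadicAlgCl p))).mulVecLin with ht₁_def
      have hker₁' : LinearMap.ker t₁ = T.map i := by rw [hker₁, hmapT]
      have hk₁t : LinearMap.ker t₁ ≤ LinearMap.ker t := by
        rw [hker₁', ← hex]; exact LinearMap.map_le_range
      have hUk : U ⊓ LinearMap.ker t ≤ LinearMap.ker t₁ := by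
        rintro u ⟨huU, huk⟩
        rw [← hex] at huk
        obtain ⟨x, rfl⟩ := LinearMap.mem_range.1 huk
        rw [hker₁']
        exact Submodule.mem_map_of_mem (hUsT (show x ∈ Us from huU))
      have hinf : U ⊓ LinearMap.ker t₁ = U ⊓ LinearMap.ker t :=
        le_antisymm (inf_le_inf le_rfl hk₁t) (le_inf inf_le_left hUk)
      have ht₁ne : t₁ ≠ 0 := by
        intro h0
        have hkt : LinearMap.ker t = ⊤ :=
          eq_top_iff.2 (le_trans (LinearMap.ker_eq_top.2 h0).symm.le hk₁t)
        exact hne (LinearMap.ker_eq_top.1 hkt)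
      have hd₁0 : 0 < d₁ := pos_of_ne_zero ht₁ne
      have hmap₁ : finrank (PadicAlgCl p) (U.map t₁) = n' := by
        have e1 := finrank_map_add_finrank_inf_ker t₁ U
        have e2 := finrank_map_add_finrank_inf_ker t U
        rw [hinf] at e1
        omega
      have hmin₁ := hmin d₁ t₁ hsurj₁ (isRationalMap_mulVecLin_map A₁) ht₁ne
      rw [hmap₁] at hmin₁
      have hd₁R : (0 : ℝ) < d₁ := by exact_mod_cast hd₁0
      have hd₁d' : d₁ ≤ d' := by
        rw [div_le_div_iff₀ hd'R hd₁R] at hmin₁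
        have : (d₁ : ℝ) ≤ d' := le_of_mul_le_mul_left (by linarith) hn'R
        exact_mod_cast this
      have hT₁dim : finrank (padicQbar p) T₁ = finrank (PadicAlgCl p) T := by
        rw [hT₁, ← LinearEquiv.finrank_eq (Submodule.equivMapOfInjective _ hBinj T₀),
          ← finrank_spanK (K := PadicAlgCl p) T₀, hTeq]
      have hTa : finrank (PadicAlgCl p) T = a := by
        apply le_antisymm
        · simpa using T.finrank_le
        · rw [hT₁dim] at hd₁
          omega
      exact Submodule.eq_top_of_finrank_eq (by rw [hTa, finrank_fin_fun])
    -- the induction hypothesis for `U* ⊆ K^a`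
    obtain ⟨hns0, hnsa, hZs⟩ := ih a ha_lt ha0 Us hUs0 hUsenv
    set ns := finrank (PadicAlgCl p) Us with hns_def
    -- `Z* = i⁻¹(Z)`
    set iF := i.restrictScalars (padicQbar p) with hiF_def
    have hiinjF : Function.Injective iF := fun x y h => hiinj h
    set Zs : Submodule (padicQbar p) (Fin a → PadicAlgCl p) := Z.comap iF with hZs_def
    have hZsfin : Module.Finite (padicQbar p) Zs := by
      haveI := hZfin
      refine Module.Finite.of_injective (iF.restrict (p := Zs) (q := Z) fun x hx => hx) ?_
      intro x y hxy
      apply Subtype.ext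
      apply hiinjF
      have := congrArg Subtype.val hxy
      simpa using this
    have hZsU : Zs ≤ Us.restrictScalars (padicQbar p) := fun z hz => hZU hz
    have hZslog : ∀ z ∈ Zs, ∀ k, z k ∈ logLinearForms p := by
      intro z hz k
      rw [← hCi z]
      exact mulVec_map_mem_logLinearForms C (fun j => hZlog _ hz j) k
    have hls := hZs Zs hZsfin hZsU hZslog
    set ls := finrank (padicQbar p) Zs with hls_def
    -- `n = n* + n'`, `l = l* + l'`, `d = a + d'`
    have hnsum : n' + ns = n := finrank_map_add_finrank_comap i t hiinj hex U
    have hexF : LinearMap.range iF = LinearMap.ker (t.restrictScalars (padicQbar p)) :=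
      range_restrictScalars_eq_ker hex
    have hlsum : l' + ls = finrank (padicQbar p) Z := by
      haveI := hZfin
      exact finrank_map_add_finrank_comap iF (t.restrictScalars (padicQbar p)) hiinjF hexF Z
    have hphi := phi_add_le hns0 hnsa hn'0 hn'd'
    rw [show ns + n' = n by omega, had] at hphi
    have hlR : (finrank (padicQbar p) Z : ℝ) = ls + l' := by
      have : ((l' + ls : ℕ) : ℝ) = finrank (padicQbar p) Z := by exact_mod_cast hlsum
      push_cast at this
      linarith
    rw [hlR]
    linarith

/-- The consumer's instance, now conditional on Theorem 4 only: `dim_ℚ̄(U ∩ 𝓛̃⁵) ≤ 20` for a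
`4`-dimensional `U ⊆ K⁵` with `U ∩ ℚ̄⁵ = 0` and envelope `K⁵` (`φ(4,5) = 20`).
[cite: Roy1992, §5 Theorem 5 (p. 39) and Lemma (p. 40)] -/
theorem roy1992_padic_thm4.finrank_le_twenty (h4 : roy1992_padic_thm4 p)
    (U : Submodule (PadicAlgCl p) (Fin 5 → PadicAlgCl p)) (hU : finrank (PadicAlgCl p) U = 4)
    (h0 : ∀ u ∈ U, (∀ i, u i ∈ padicQbar p) → u = 0)
    (henv : ∀ T : Submodule (PadicAlgCl p) (Fin 5 → PadicAlgCl p),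
      IsRationalSubspace T → U ≤ T → T = ⊤)
    (Z : Submodule (padicQbar p) (Fin 5 → PadicAlgCl p)) [Module.Finite (padicQbar p) Z]
    (hZU : Z ≤ U.restrictScalars (padicQbar p)) (hZ : ∀ z ∈ Z, ∀ i, z i ∈ logLinearForms p) :
    finrank (padicQbar p) Z ≤ 20 :=
  (roy1992_padic_thm5_of_thm4 p h4).finrank_le_twenty p U hU h0 henv Z hZU hZ

end ThmFive

end Literature.NumberTheory.Transcendental
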